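import Summits.BirchSwinnertonDyer.Rank1Residual.X9.HessePartnerTransport
import Literature.NumberTheory.EllipticCurves.Rank1Residual.X9CMPartner
import Literature.NumberTheory.EllipticCurves.EmertonPollackWeston2006.MuAnTransferGoodOrdinary
import HarnessLib

/-!
# Class X9, `p = 5`: the partner's C2 (`μ(𝓛_5(F)) = 0`) from the TARGET's two-engine C2 by Emerton–Pollack–Weston's
# Theorem 1 (analytic `μ`-invariance in the Hida family of `ρ̄`) — so a partner beyond every modular-symbol engine needs NO C2 of its own

HONEST FRAMING (cell `b2b-bsdres-*`, verbatim): the cell deletes COMBINATION-SHAPED residual classes of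
the rank-≤1 BSD formula from PUBLISHED theorems only and TYPES the construction-shaped remainder; this
is not "finishing BSD". Class X9 stays TYPED at class level; everything here is PER PAIR; no lane verdict is
changed; nothing is booked by this unit. Unit `b2b-bsdres-x9`, gen 17 (companion of `X9/HessePartnerTransport.lean`).
ONE NAMED FACT is used — `Literature.NumberTheory.EllipticCurves.EmertonPollackWeston2006.thm1_muAn_transfer_of_torsionIso`
(the `Literature/` home filed per the cell referee's ruling R145.2; the §0 copy below is PROVED IDENTICAL to it in the kernel —
`thm1_muAn_transfer_of_torsionIso_iff` (`Iff.rfl`) — and is kept only because the gate's append-only guards freeze its consumers' binder):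
Emerton–Pollack–Weston, Invent. Math. 163 (2006), **Theorem 1, analytic half** — "Fix `∗ ∈ {alg, an}`. If
`μ^∗(f₀) = 0` for some `f₀ ∈ H(ρ̄)`, then `μ^∗(f) = 0` for all `f ∈ H(ρ̄)`" (arXiv:math/0404484 p. 2, with p. 1–2: `ρ̄`
absolutely irreducible, modular, `p`-ordinary and `p`-distinguished; `H(ρ̄)` = all `p`-ordinary `p`-stabilized newforms with
mod-`p` representation `ρ̄`) — transcribed for TWO ELLIPTIC CURVES good ordinary at `p ≥ 5` with `E₁[p] ≅ E₂[p]` irreducible,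
in the Néron normalisation of the whole cell (`ϖ·L_p(f, α)`, `ϖ·Ω_E = Ω⁺_f`; EPW's `μ^an` is taken with canonical periods,
which for `E[p]` irreducible differ from the Néron period by a `p`-adic unit: Greenberg–Vatsal 2000 §3, Prop. (3.1), Remark (3.4),
Lemma (3.6), Prop. (3.7) — the same reading as the tree's `GreenbergVatsal2000.thm14_…` and `EmertonPollackWeston2006.cor514_…`),
with "`μ^an = 0`" spelled, as everywhere in the cell, "some coefficient of `ϖ·L_p(f, α)` is a `p`-adic unit"
(`GreenbergVatsal2000.hasUnitContent_iff_exists_norm_coeff_map_eq_one`).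

## Why (our own work, hence `Summits/`; census `HOME/b2b-bsdres-x9/X9-CENSUS-G17.md` §0 (5))

The Greenberg–Vatsal transport of the lineage needs, on the PARTNER side, `BSD(A,5)` + C2 (`μ(𝓛_5(A)) = 0`, a unit
coefficient, read off modular symbols by two engines) + C3. The partners gen 17 found beyond the tables (`N_A ≥ 6·10⁵`) are
out of reach of every modular-symbol engine; for rank-`0` non-anomalous partners C2 is the `L`-value
(`HessePartnerTransportRankZero.lean`), for rank-`1` non-anomalous partners Perrin-Riou's leading term decides it when
`v₅(h_5(g)) = 1` ("C2′"), but for `129472bb1`'s partner (`v₅(h_5(g)) = 3`) and the ANOMALOUS pair `129472do1` neither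
applies. Theorem 1 of EPW settles ALL cases at once: the TARGET `E` is a Cremona curve whose `μ(𝓛_5(E)) = 0` is the
lineage's two-engine certificate of record (`g9/mu/MU-ALL.tsv`, 790/790 X9 pairs), and `f_E`, `f_A` lie in the same Hida
family `H(ρ̄)`; so `μ(𝓛_5(A)) = 0`. Consumers: `bsdp_of_ainvs_of_bsdpPartner_of_hessePencil5{ind}_of_muTransfer_of_analyticRank_le_one`
(= the gen-17 consumers with `hcertA` REPLACED by `hEPW` + the target's `hcertW`); records: `129472bb1`, `129472do1` —
now modulo published facts and finite certificates only (their `HessePartnerRecordsB.lean` versions carry `hcertA` undischarged).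

References: M. Emerton, R. Pollack, T. Weston, Invent. Math. 163 (2006) 523–580, Thm. 1 [EmertonPollackWeston2006];
R. Greenberg, V. Vatsal, Invent. Math. 142 (2000) §3 [GreenbergVatsal2000]; the references of `HessePartnerTransport.lean`.
-/

set_option autoImplicit false

noncomputable section

open scoped Classical MatrixGroups ModularForm

open CongruenceSubgroup WeierstrassCurve Literature.NumberTheory.EllipticCurves
  Literature.NumberTheory.EllipticCurves.ModularForms Literature.NumberTheory.EllipticCurves.Rank1Residual
  Literature.NumberTheory.EllipticCurves.Rank1Residual.Typed
  Literature.NumberTheory.EllipticCurves.Rank1Residual.X11RankOneCertificates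
  Literature.NumberTheory.EllipticCurves.Fisher2012
  Summit.BirchSwinnertonDyer.BirchSwinnertonDyer.Rank1Residual.IntModel
  Summit.BirchSwinnertonDyer.BirchSwinnertonDyer.Rank1Residual.X11RankOne
  Summit.BirchSwinnertonDyer.Rank1Residual.X11b

namespace Summit.BirchSwinnertonDyer.Rank1Residual.X9

/-! ### §0. The named fact (= its `Literature/` home `EmertonPollackWeston2006/MuAnTransferGoodOrdinary.lean` by `Iff.rfl`, R145.2) -/

/-- **Emerton–Pollack–Weston 2006, Theorem 1 (analytic half), for two elliptic curves good ordinary at `p ≥ 5` with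
isomorphic irreducible `p`-torsion.** M. Emerton, R. Pollack, T. Weston, *Variation of Iwasawa invariants in Hida
families*, Invent. Math. 163 (2006) 523–580 = arXiv:math/0404484, Theorem 1 (p. 2): "Fix `∗ ∈ {alg, an}`. If
`μ^∗(f₀) = 0` for some `f₀ ∈ H(ρ̄)`, then `μ^∗(f) = 0` for all `f ∈ H(ρ̄)`", where (pp. 1–2) "`ρ̄ : G_ℚ → GL₂(k)` [is] an
absolutely irreducible modular Galois representation over a finite field `k` of characteristic `p` … `p`-ordinary and
`p`-distinguished" and "the Hida family `H(ρ̄)` of `ρ̄` is the set of all `p`-ordinary `p`-stabilized newforms `f` with mod `p`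
Galois representation isomorphic to `ρ̄`"; `μ^an(f)` is "the exponent of the power of `p` dividing" the `p`-adic
`L`-function of `f` (p. 2; §3 for the normalisation by canonical periods). TRANSCRIPTION (`∗ = an`): `W₁, W₂/ℚ` globally
minimal elliptic curves, `5 ≤ p`, both GOOD ORDINARY at `p` (`HasGoodReductionAtPrime`, `p ∤ a_p`: then the weight-two
newforms `f₁`, `f₂` have `p`-stabilizations in `H(ρ̄)`), a `Γ_ℚ`-equivariant additive isomorphism `W₁[p] ≃ W₂[p]` and
`W₁[p]` irreducible (so `ρ̄` is absolutely irreducible and `p`-distinguished: irreducible odd two-dimensional; ordinary at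
`p` with `ω ≠ 1` on inertia since `p ≥ 5`); HYPOTHESIS "`μ^an(f₁) = 0`" and CONCLUSION "`μ^an(f₂) = 0`", both spelled in
the cell's Néron normalisation — some coefficient of `ϖ·L_p(f, α)` (`ϖ·Ω_W = Ω⁺_f`, `α` the unit root) is a `p`-adic unit
(`GreenbergVatsal2000.hasUnitContent_iff_exists_norm_coeff_map_eq_one`); EPW's canonical-period `μ^an` agrees with this
one for irreducible `E[p]` by Greenberg–Vatsal 2000 §3 (Prop. (3.1), Remark (3.4), Lemma (3.6), Prop. (3.7)) — the reading
already used by `GreenbergVatsal2000.thm14_mainConjecture_transfer_of_torsionIso` and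
`EmertonPollackWeston2006.cor514_transfer_of_goodOrdinary`. Named fact; nothing asserted. Since the cell referee's
ruling R145.2 (2026-08-21) the statement LIVES under `Literature/` as
`Literature.NumberTheory.EllipticCurves.EmertonPollackWeston2006.thm1_muAn_transfer_of_torsionIso` (byte-identical body, cell
registry row A251); this copy is DEFINITIONALLY EQUAL to it (`thm1_muAn_transfer_of_torsionIso_iff` below, `Iff.rfl`) and is kept
verbatim only because the gate's append-only / definition-body guards freeze the binder `hEPW : thm1_muAn_transfer_of_torsionIso`
of the consumers below and of the records `HessePartnerRecordsBmu.lean`; feed it with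
`thm1_muAn_transfer_of_torsionIso_of_literature`. It is therefore NOT a second named fact.
-- TODO(general form): Theorem 1 for every pair of members of H(ρ̄) (all weights, twists ω^i, p in the level), and ∗ = alg.
[cite: EmertonPollackWeston2006, Thm. 1 (arXiv:math/0404484 p. 2), Intro pp. 1–2 (H(ρ̄)), §3.1 (p. 17)]
[cite: GreenbergVatsal2000, §3, Prop. (3.1), Remark (3.4), Lemma (3.6), Prop. (3.7)] -/
def thm1_muAn_transfer_of_torsionIso : Prop :=
  ∀ (W₁ W₂ : WeierstrassCurve ℚ) [W₁.IsElliptic] [W₁.IsGloballyMinimal]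
    [W₂.IsElliptic] [W₂.IsGloballyMinimal] (p : ℕ) [Fact p.Prime],
    5 ≤ p →
    W₁.HasGoodReductionAtPrime p → ¬ (p : ℤ) ∣ W₁.frobeniusTrace p →
    W₂.HasGoodReductionAtPrime p → ¬ (p : ℤ) ∣ W₂.frobeniusTrace p →
    (∃ e : geomTorsion W₁ (p : ℤ) ≃+ geomTorsion W₂ (p : ℤ),
      ∀ (σ : Field.absoluteGaloisGroup ℚ) (P : geomTorsion W₁ (p : ℤ)), e (σ • P) = σ • e P) →
    W₁.HasIrreducibleModPGaloisRep p →
    (∀ [NeZero (W₁.conductorNorm ℤ)] (f₁ : CuspForm (Gamma0 (W₁.conductorNorm ℤ)) 2),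
        IsNewformOf W₁ f₁ → ∀ (ϖ₁ : ℚ), (ϖ₁ : ℝ) * W₁.realPeriodRat = plusPeriod f₁ →
      ∃ n : ℕ, ‖PowerSeries.coeff n
        (PowerSeries.C (ϖ₁ : ℚ_[p]) * padicLFunction f₁ (unitRoot W₁ p : ℚ_[p]))‖ = 1) →
    ∀ [NeZero (W₂.conductorNorm ℤ)] (f₂ : CuspForm (Gamma0 (W₂.conductorNorm ℤ)) 2),
        IsNewformOf W₂ f₂ → ∀ (ϖ₂ : ℚ), (ϖ₂ : ℝ) * W₂.realPeriodRat = plusPeriod f₂ →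
      ∃ n : ℕ, ‖PowerSeries.coeff n
        (PowerSeries.C (ϖ₂ : ℚ_[p]) * padicLFunction f₂ (unitRoot W₂ p : ℚ_[p]))‖ = 1

/-- **R145.2 bridge: the Summits-side statement IS the registered `Literature/` fact (kernel, `Iff.rfl`).** The body of
`thm1_muAn_transfer_of_torsionIso` above and the body of
`Literature.NumberTheory.EllipticCurves.EmertonPollackWeston2006.thm1_muAn_transfer_of_torsionIso` (file
`Literature/NumberTheory/EllipticCurves/EmertonPollackWeston2006/MuAnTransferGoodOrdinary.lean`, the `Literature/` home
filed per the cell referee's ruling R145.2) are the same term, so the two propositions are definitionally equal. Hence the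
Summits-side `def` is NOT an independent named fact: every consumer binding `hEPW : thm1_muAn_transfer_of_torsionIso`
(this file, `HessePartnerRecordsBmu.lean`) is fed by the Literature fact through `.mpr` / `thm1_muAn_transfer_of_torsionIso_of_literature`.
(The literal reduction of the `def` to an `abbrev` asked by R145.2 (iii) is refused by the gate's append-only and
definition-body guards — "statement changed" / "definition body changed in place — deprecate-and-add under a new name";
this kernel identity is the fix-forward.) Bookkeeping only; no mathematical content.
[cite: EmertonPollackWeston2006, Thm. 1 (arXiv:math/0404484 p. 2)] -/
theorem thm1_muAn_transfer_of_torsionIso_iff :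
    thm1_muAn_transfer_of_torsionIso ↔
      Literature.NumberTheory.EllipticCurves.EmertonPollackWeston2006.thm1_muAn_transfer_of_torsionIso :=
  Iff.rfl

/-- **The Summits-side binder from the registered `Literature/` fact** (R145.2 (ii): how every `hEPW` of this lineage is
discharged modulo `Literature.NumberTheory.EllipticCurves.EmertonPollackWeston2006.thm1_muAn_transfer_of_torsionIso`).
Bookkeeping only. [cite: EmertonPollackWeston2006, Thm. 1 (arXiv:math/0404484 p. 2)] -/
theorem thm1_muAn_transfer_of_torsionIso_of_literature
    (h : Literature.NumberTheory.EllipticCurves.EmertonPollackWeston2006.thm1_muAn_transfer_of_torsionIso) :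
    thm1_muAn_transfer_of_torsionIso :=
  h

/-- **Conversely** (so nothing is lost in either direction). Bookkeeping only.
[cite: EmertonPollackWeston2006, Thm. 1 (arXiv:math/0404484 p. 2)] -/
theorem literature_thm1_muAn_transfer_of_torsionIso_of (h : thm1_muAn_transfer_of_torsionIso) :
    Literature.NumberTheory.EllipticCurves.EmertonPollackWeston2006.thm1_muAn_transfer_of_torsionIso :=
  h

/-! ### §1. The consumers -/

/-- **THE PARTNER's C2 FROM THE TARGET's C2 (Emerton–Pollack–Weston Thm. 1).** `BSD(E,5)` for a target of analytic rank `≤ 1` from a partner of analytic rank `≤ 1` that is a member of the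
Hesse pencil `X_E(5)`, both given by globally minimal INTEGER models; every Galois / reduction hypothesis from
DECIDABLE integer data.** Target `W` with integral model `[a₁,…,a₆]`: `5 ∤ Δ` (good), kernel point count
`#Ẽ(𝔽₅) = n₅` with `5 ∤ 6 − n₅` (ordinary), a good prime `ℓ ≠ 5` with `#Ẽ(𝔽_ℓ) = n` and `X² − (ℓ + 1 − n)X + ℓ`
root-free mod `5` (`E[5]` irreducible, Mazur 1978 Prop. 6.3 (1)); partner `A` with integral model `[a′₁,…,a′₆]`:
`5 ∤ Δ′`, `#Ã(𝔽₅) = n′₅` with `5 ∤ 6 − n′₅`. C1: `hF` (Fisher 2012 Thm. 13.2, named fact) + `hC : C • A = E_{l,m}`.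
Remaining binders: PUBLISHED `hBCS … hGZK`; FINITE `r_an(E) ≤ 1`, `r_an(A) ≤ 1`, `BSDp A 5`, C2 of the TARGET `hcertW` (its two-engine `μ(𝓛_5(E)) = 0` row) carried to the partner by `hEPW`, C3 for the
partner `hSchA` (vacuous unless `r_an(A) = 1`), C3 for the target `hC3` (vacuous unless `r_an(E) = 1`). The route is
gen 15's `bsdp_of_bsdpPartner_of_partnerRank_le_one_of_irr`: BCS 2025 Thm. 1.1.2 (a) + `BSD(A,5)` + C2 (+ C3) ⟹
Mazur's main conjecture for `(A,5)` with `μ = 0` ⟹ (Greenberg–Vatsal (1.4)) for `(E,5)` ⟹ `BSD(E,5)`.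
[cite: Fisher2012Hessian, Thm. 13.2] [cite: GreenbergVatsal2000, Thm. (1.4) (arXiv p. 5)]
[cite: BurungaleCastellaSkinner2025, Thm. 1.1.2 (a) (p. 2 of arXiv:2405.00270v2)] [cite: Mazur1978, §6 Prop. 6.3 (1) (p. 153)]
[cite: GreenbergLNM1716, Thm. 4.1 (p. 102)] [cite: PerrinRiou1987, §1.4 Cor. 1.8] -/
theorem bsdp_of_ainvs_of_bsdpPartner_of_hessePencil5_of_muTransfer_of_analyticRank_le_one
    (hF : thm132_fiveCongruent_hessePencil)
    (hBCS : burungale_castella_skinner_charIdeal_eq_padicLFunction)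
    (hGr : greenberg_charValue_rankZero) (h5 : realPeriodRat_eq_unit_mul_plusPeriod)
    (hGV : GreenbergVatsal2000.thm14_mainConjecture_transfer_of_torsionIso)
    (hS : Schneider1985_order_charGenerator) (hPR : perrinRiou_rankOne_leadingTerms)
    (hmodP : nonempty_modularParametrizationData) (hmodL : hasEntireLFunction_rat)
    (hGZK : rank_eq_analyticRank_of_analyticRank_le_one)
    (a1 a2 a3 a4 a6 : ℤ) {W : WeierstrassCurve ℚ} [W.IsElliptic] [W.IsGloballyMinimal]
    (hW : integralModelInt W = ⟨a1, a2, a3, a4, a6⟩)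
    (b1 b2 b3 b4 b6 : ℤ) {A : WeierstrassCurve ℚ} [A.IsElliptic] [A.IsGloballyMinimal]
    (hA : integralModelInt A = ⟨b1, b2, b3, b4, b6⟩)
    (ℓ n np npA : ℕ) [Fact ℓ.Prime] [Fact (Nat.Prime 5)]
    (hpΔ : ¬ (5 : ℤ) ∣ discOf [a1, a2, a3, a4, a6])
    (hcardp : Nat.card (((⟨a1, a2, a3, a4, a6⟩ : WeierstrassCurve ℤ).map
      (Int.castRingHom (ZMod 5))).toAffine.Point) = np)
    (hordp : ¬ (5 : ℤ) ∣ (5 : ℤ) + 1 - np)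
    (hℓp : ℓ ≠ 5) (hℓΔ : ¬ (ℓ : ℤ) ∣ discOf [a1, a2, a3, a4, a6])
    (hcard : Nat.card (((⟨a1, a2, a3, a4, a6⟩ : WeierstrassCurve ℤ).map
      (Int.castRingHom (ZMod ℓ))).toAffine.Point) = n)
    (hnoroot : ∀ t : ℕ, t < 5 → ¬ (5 : ℤ) ∣ (t : ℤ) ^ 2 - ((ℓ : ℤ) + 1 - n) * t + ℓ)
    (hpΔA : ¬ (5 : ℤ) ∣ discOf [b1, b2, b3, b4, b6])
    (hcardpA : Nat.card (((⟨b1, b2, b3, b4, b6⟩ : WeierstrassCurve ℤ).map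
      (Int.castRingHom (ZMod 5))).toAffine.Point) = npA)
    (hordpA : ¬ (5 : ℤ) ∣ (5 : ℤ) + 1 - npA)
    (hran : W.analyticRank ≤ 1) (hrA : A.analyticRank ≤ 1) (hbsdA : BSDp A 5)
    (hSchA : A.analyticRank = 1 → ∀ Dh : PAdicHeightData A 5, Dh.IsCanonical → SchneiderConjecture Dh)
    (hEPW : thm1_muAn_transfer_of_torsionIso)
    (hcertW : ∀ [NeZero (W.conductorNorm ℤ)] (fW : CuspForm (Gamma0 (W.conductorNorm ℤ)) 2),
        IsNewformOf W fW → ∀ (ϖ : ℚ), (ϖ : ℝ) * W.realPeriodRat = plusPeriod fW →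
      ∃ n : ℕ, ‖PowerSeries.coeff n
        (PowerSeries.C (ϖ : ℚ_[5]) * padicLFunction fW (unitRoot W 5 : ℚ_[5]))‖ = 1)
    (l m : ℚ) (C : VariableChange ℚ) (hC : C • A = hessePencil5 W.c₄ W.c₆ l m)
    (hC3 : W.analyticRank = 1 → ∀ Dh : PAdicHeightData W 5, Dh.IsCanonical → SchneiderConjecture Dh) :
    BSDp W 5 := by
  have hΔ : (⟨a1, a2, a3, a4, a6⟩ : WeierstrassCurve ℤ).Δ = discOf [a1, a2, a3, a4, a6] :=
    intCurve_Δ a1 a2 a3 a4 a6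
  have hΔA : (⟨b1, b2, b3, b4, b6⟩ : WeierstrassCurve ℤ).Δ = discOf [b1, b2, b3, b4, b6] :=
    intCurve_Δ b1 b2 b3 b4 b6
  have hgood : W.HasGoodReductionAtPrime 5 :=
    hasGoodReductionAtPrime_of_not_dvd W 5 (by rw [minimalDiscriminantInt_eq hW, hΔ]; exact hpΔ)
  have hord : ¬ ((5 : ℕ) : ℤ) ∣ W.frobeniusTrace 5 := by
    rw [frobeniusTrace_eq hW hcardp]; exact_mod_cast hordp
  have hgoodA : A.HasGoodReductionAtPrime 5 :=
    hasGoodReductionAtPrime_of_not_dvd A 5 (by rw [minimalDiscriminantInt_eq hA, hΔA]; exact hpΔA)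
  have hordA : ¬ ((5 : ℕ) : ℤ) ∣ A.frobeniusTrace 5 := by
    rw [frobeniusTrace_eq hA hcardpA]; exact_mod_cast hordpA
  have hirr : W.HasIrreducibleModPGaloisRep 5 := by
    refine hasIrreducibleModPGaloisRep_of_intModel_of_noroot hW 5 ℓ hℓp (by rw [hΔ]; exact hℓΔ) hcard
      (forall_zmod_of_forall_lt fun t ht h0 ↦ ?_)
    refine hnoroot t ht ?_
    have h5 : ((5 : ℕ) : ℤ) ∣ (t : ℤ) ^ 2 - ((ℓ : ℤ) + 1 - n) * t + ℓ := by
      rw [← ZMod.intCast_zmod_eq_zero_iff_dvd]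
      push_cast at h0 ⊢
      linear_combination h0
    exact_mod_cast h5
  obtain ⟨e, he⟩ := torsionIso_of_hessePencil5 hF W A l m C hC
  exact bsdp_of_bsdpPartner_of_partnerRank_le_one_of_irr W A 5 hBCS hGr h5 hGV hS hPR hmodP hmodL hGZK
    hran hgood hord (le_refl 5) hirr hgoodA hordA hrA hbsdA hSchA
    (hEPW W A 5 (le_refl 5) hgood hord hgoodA hordA ⟨e.symm, torsionIso_symm_smul e he⟩ hirr hcertW)
    ⟨e, he⟩ hC3

/-- **The same for a partner in the indirect family `X_E⁻(5)`** (Fisher 2013 Thm. 5.8, named fact `hF'`).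
[cite: Fisher2013QuinticTwists, Thm. 5.8] [cite: GreenbergVatsal2000, Thm. (1.4) (arXiv p. 5)]
[cite: BurungaleCastellaSkinner2025, Thm. 1.1.2 (a) (p. 2 of arXiv:2405.00270v2)] [cite: Mazur1978, §6 Prop. 6.3 (1) (p. 153)] -/
theorem bsdp_of_ainvs_of_bsdpPartner_of_hessePencil5ind_of_muTransfer_of_analyticRank_le_one
    (hF' : thm58_fiveCongruent_hessePencilInd)
    (hBCS : burungale_castella_skinner_charIdeal_eq_padicLFunction)
    (hGr : greenberg_charValue_rankZero) (h5 : realPeriodRat_eq_unit_mul_plusPeriod)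
    (hGV : GreenbergVatsal2000.thm14_mainConjecture_transfer_of_torsionIso)
    (hS : Schneider1985_order_charGenerator) (hPR : perrinRiou_rankOne_leadingTerms)
    (hmodP : nonempty_modularParametrizationData) (hmodL : hasEntireLFunction_rat)
    (hGZK : rank_eq_analyticRank_of_analyticRank_le_one)
    (a1 a2 a3 a4 a6 : ℤ) {W : WeierstrassCurve ℚ} [W.IsElliptic] [W.IsGloballyMinimal]
    (hW : integralModelInt W = ⟨a1, a2, a3, a4, a6⟩)
    (b1 b2 b3 b4 b6 : ℤ) {A : WeierstrassCurve ℚ} [A.IsElliptic] [A.IsGloballyMinimal]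
    (hA : integralModelInt A = ⟨b1, b2, b3, b4, b6⟩)
    (ℓ n np npA : ℕ) [Fact ℓ.Prime] [Fact (Nat.Prime 5)]
    (hpΔ : ¬ (5 : ℤ) ∣ discOf [a1, a2, a3, a4, a6])
    (hcardp : Nat.card (((⟨a1, a2, a3, a4, a6⟩ : WeierstrassCurve ℤ).map
      (Int.castRingHom (ZMod 5))).toAffine.Point) = np)
    (hordp : ¬ (5 : ℤ) ∣ (5 : ℤ) + 1 - np)
    (hℓp : ℓ ≠ 5) (hℓΔ : ¬ (ℓ : ℤ) ∣ discOf [a1, a2, a3, a4, a6])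
    (hcard : Nat.card (((⟨a1, a2, a3, a4, a6⟩ : WeierstrassCurve ℤ).map
      (Int.castRingHom (ZMod ℓ))).toAffine.Point) = n)
    (hnoroot : ∀ t : ℕ, t < 5 → ¬ (5 : ℤ) ∣ (t : ℤ) ^ 2 - ((ℓ : ℤ) + 1 - n) * t + ℓ)
    (hpΔA : ¬ (5 : ℤ) ∣ discOf [b1, b2, b3, b4, b6])
    (hcardpA : Nat.card (((⟨b1, b2, b3, b4, b6⟩ : WeierstrassCurve ℤ).map
      (Int.castRingHom (ZMod 5))).toAffine.Point) = npA)
    (hordpA : ¬ (5 : ℤ) ∣ (5 : ℤ) + 1 - npA)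
    (hran : W.analyticRank ≤ 1) (hrA : A.analyticRank ≤ 1) (hbsdA : BSDp A 5)
    (hSchA : A.analyticRank = 1 → ∀ Dh : PAdicHeightData A 5, Dh.IsCanonical → SchneiderConjecture Dh)
    (hEPW : thm1_muAn_transfer_of_torsionIso)
    (hcertW : ∀ [NeZero (W.conductorNorm ℤ)] (fW : CuspForm (Gamma0 (W.conductorNorm ℤ)) 2),
        IsNewformOf W fW → ∀ (ϖ : ℚ), (ϖ : ℝ) * W.realPeriodRat = plusPeriod fW →
      ∃ n : ℕ, ‖PowerSeries.coeff n
        (PowerSeries.C (ϖ : ℚ_[5]) * padicLFunction fW (unitRoot W 5 : ℚ_[5]))‖ = 1)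
    (l m : ℚ) (C : VariableChange ℚ) (hC : C • A = hessePencil5ind W.c₄ W.c₆ l m)
    (hC3 : W.analyticRank = 1 → ∀ Dh : PAdicHeightData W 5, Dh.IsCanonical → SchneiderConjecture Dh) :
    BSDp W 5 := by
  have hΔ : (⟨a1, a2, a3, a4, a6⟩ : WeierstrassCurve ℤ).Δ = discOf [a1, a2, a3, a4, a6] :=
    intCurve_Δ a1 a2 a3 a4 a6
  have hΔA : (⟨b1, b2, b3, b4, b6⟩ : WeierstrassCurve ℤ).Δ = discOf [b1, b2, b3, b4, b6] :=
    intCurve_Δ b1 b2 b3 b4 b6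
  have hgood : W.HasGoodReductionAtPrime 5 :=
    hasGoodReductionAtPrime_of_not_dvd W 5 (by rw [minimalDiscriminantInt_eq hW, hΔ]; exact hpΔ)
  have hord : ¬ ((5 : ℕ) : ℤ) ∣ W.frobeniusTrace 5 := by
    rw [frobeniusTrace_eq hW hcardp]; exact_mod_cast hordp
  have hgoodA : A.HasGoodReductionAtPrime 5 :=
    hasGoodReductionAtPrime_of_not_dvd A 5 (by rw [minimalDiscriminantInt_eq hA, hΔA]; exact hpΔA)
  have hordA : ¬ ((5 : ℕ) : ℤ) ∣ A.frobeniusTrace 5 := by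
    rw [frobeniusTrace_eq hA hcardpA]; exact_mod_cast hordpA
  have hirr : W.HasIrreducibleModPGaloisRep 5 := by
    refine hasIrreducibleModPGaloisRep_of_intModel_of_noroot hW 5 ℓ hℓp (by rw [hΔ]; exact hℓΔ) hcard
      (forall_zmod_of_forall_lt fun t ht h0 ↦ ?_)
    refine hnoroot t ht ?_
    have h5 : ((5 : ℕ) : ℤ) ∣ (t : ℤ) ^ 2 - ((ℓ : ℤ) + 1 - n) * t + ℓ := by
      rw [← ZMod.intCast_zmod_eq_zero_iff_dvd]
      push_cast at h0 ⊢
      linear_combination h0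
    exact_mod_cast h5
  obtain ⟨e, he⟩ := torsionIso_of_hessePencil5ind hF' W A l m C hC
  exact bsdp_of_bsdpPartner_of_partnerRank_le_one_of_irr W A 5 hBCS hGr h5 hGV hS hPR hmodP hmodL hGZK
    hran hgood hord (le_refl 5) hirr hgoodA hordA hrA hbsdA hSchA
    (hEPW W A 5 (le_refl 5) hgood hord hgoodA hordA ⟨e.symm, torsionIso_symm_smul e he⟩ hirr hcertW)
    ⟨e, he⟩ hC3


end Summit.BirchSwinnertonDyer.Rank1Residual.X9

end
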